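import Summits.Ventures.Crystal3D.Theorems.StickyWulffConstantCoaxialWallLawTriadicRegistry
import HarnessLib

/-!
# CHAIN CYCLICITY: along one forced ray the registry grows CYCLICALLY — `A·Λ₀ + Σ_{j≤k} F_j·Λ₀ ⊆ A·Λ₀ + ℤ·g_k` with
# `g_k = √(2/3)·ν_k`, and `3·g_{k+1} ≡ (12β+5)·g_k` (crux `CoaxialWallLaw`, stmt-Ventures-19481, line `WallLedgerF`)

HONEST FRAMING. Venture `Summits/Ventures/Crystal3D` (cell `crystal3d-full`), helper `--supports` the crux `CoaxialWallLaw`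
of `route-Ventures-StickyWulffConstant` (REGISTERED line `WallLedgerF`, open stub `stub_coaxialTwoSlabAdhesion`).  Algebra of
lane G's forced rays (`forcedTop`, `chainFrames`, 19480-p2); rung credit only; F-C1 not moved; NOT the stub.

THE STRUCTURE THEOREM.  Let `F_0 = R_n A`, `F_{k+1} = R_{ν_{k+1}} F_k` be the forced ray over `(A, u)` with first push normal
`n` (`ν_0 = n`, `ν_{k+1} = 2√(2/3)·c_k − ν_k`, `c_k = F_k δ_k` the best capper: a slot of `F_k·Λ₀` positive for `ν_k`), and put
`g_k = √(2/3)·ν_k` (a DSC vector of the twin pair `(F_{k−1}, F_k)`), `M = A·Λ₀`.  Then (`forcedTop_chain_invariant`) for all `k`: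
* `ν_k` is a unit menu normal of `F_k`; every frame `F_j`, `j ≤ k`, maps `Λ₀` into `M + ℤ·g_k`, and the frame below,
  `R_{ν_k}F_k = F_{k−1}`, into `M + 3ℤ·g_k`;
* `3^{k+1}·g_k ∈ M`, and `3^k·g_k ≡ w·g_0 (mod M)` with `3 ∤ w`;
* the RECURSION `3·g_{k+1} ≡ (12β+5)·g_k (mod M)` for some `β ∈ ℤ`, and `g_k ∈ M + 3ℤ·g_{k+1}`.
Mechanism (`chain_step`): `c_k = y + 2g_k` with `y = R_{ν_k}c_k ∈ F_{k−1}·Λ₀ ⊆ M + 3ℤg_k`, so `c_k ≡ (3b+2)g_k` and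
`3g_{k+1} = 4c_k − 3g_k ≡ (12b+5)g_k`; `12b+5` is prime to `3`, so the quotient `(M + Σ F_j·Λ₀)/M` stays CYCLIC, generated by
`g_k`, of order `3^{k+1}` — its only elements of order `3` are the multiples of `g_0`: the fault coset of the FIRST twin plane.
Consumed by `…CoaxialWallLawChainTorsion` (two rays through the two planes containing `u` ⇒ the level-⅓ part of the one-sided
registry is exactly `Λ₀ + ℤb_n + ℤb_{n'}`).
WHAT THIS IS NOT: no packing statement; not the stub; F-C1 not moved.
-/

noncomputable section

namespace Summit.Ventures.Crystal3D.Theorems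

open Summit.Ventures.Crystal3D Finset
open Literature.MathematicalPhysics.StatisticalMechanics (fccStacking barlowStacking IsHaggSeq)
open scoped InnerProductSpace

/-! ### The moved lattice `A·Λ₀` through `A⁻¹` -/

/-- `A⁻¹`-membership is additive. -/
theorem symm_mem_fcc_add (A : EuclideanSpace ℝ (Fin 3) ≃ₗᵢ[ℝ] EuclideanSpace ℝ (Fin 3)) {v w : EuclideanSpace ℝ (Fin 3)}
    (hv : A.symm v ∈ fccStacking 1 (Real.sqrt (2 / 3))) (hw : A.symm w ∈ fccStacking 1 (Real.sqrt (2 / 3))) :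
    A.symm (v + w) ∈ fccStacking 1 (Real.sqrt (2 / 3)) := by
  rw [map_add]; exact fcc_add_site_mem hv hw

/-- `A⁻¹`-membership is closed under subtraction. -/
theorem symm_mem_fcc_sub (A : EuclideanSpace ℝ (Fin 3) ≃ₗᵢ[ℝ] EuclideanSpace ℝ (Fin 3)) {v w : EuclideanSpace ℝ (Fin 3)}
    (hv : A.symm v ∈ fccStacking 1 (Real.sqrt (2 / 3))) (hw : A.symm w ∈ fccStacking 1 (Real.sqrt (2 / 3))) :
    A.symm (v - w) ∈ fccStacking 1 (Real.sqrt (2 / 3)) := by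
  rw [map_sub]; exact fcc_sub_site_mem hv hw

/-- `A⁻¹`-membership is closed under integer multiples. -/
theorem symm_mem_fcc_zsmul (A : EuclideanSpace ℝ (Fin 3) ≃ₗᵢ[ℝ] EuclideanSpace ℝ (Fin 3)) {v : EuclideanSpace ℝ (Fin 3)}
    (a : ℤ) (hv : A.symm v ∈ fccStacking 1 (Real.sqrt (2 / 3))) :
    A.symm ((a : ℝ) • v) ∈ fccStacking 1 (Real.sqrt (2 / 3)) := by
  rw [map_smul]; exact fcc_zsmul_mem a hv

/-- `A⁻¹ 0 ∈ Λ₀`. -/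
theorem symm_mem_fcc_zero (A : EuclideanSpace ℝ (Fin 3) ≃ₗᵢ[ℝ] EuclideanSpace ℝ (Fin 3)) :
    A.symm (0 : EuclideanSpace ℝ (Fin 3)) ∈ fccStacking 1 (Real.sqrt (2 / 3)) := by
  rw [map_zero]; exact zero_mem_fccLattice

/-! ### One level of the chain -/

/-- **One chain step.**  Frame `Φ` with unit menu normal `ν`, `g = √(2/3)·ν`; a slot `δ` with `⟪Φδ, ν⟫ = √(2/3)` and the
mirrored normal `N = 2√(2/3)·Φδ − ν` (`g' = √(2/3)·N`).  If `Φ·Λ₀ ⊆ M + ℤg`, `(R_νΦ)·Λ₀ ⊆ M + 3ℤg`, `3^{k+1}g ∈ M` and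
`3^k g ≡ w g₀` (`3 ∤ w`), then: `N` is a unit menu normal of `R_NΦ`; `3g' ≡ (12β+5)g`; `g ∈ M + 3ℤg'`; `(R_NΦ)·Λ₀ ⊆ M + ℤg'`;
`Φ·Λ₀ ⊆ M + 3ℤg'`; `3^{k+2}g' ∈ M`; `3^{k+1}g' ≡ w'g₀` with `3 ∤ w'`.  (`M`-membership is spelled `A⁻¹(·) ∈ Λ₀`.) -/
theorem chain_step (A Φ : EuclideanSpace ℝ (Fin 3) ≃ₗᵢ[ℝ] EuclideanSpace ℝ (Fin 3)) {ν δ N g₀ : EuclideanSpace ℝ (Fin 3)}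
    (k : ℕ) (hν : ‖ν‖ = 1)
    (hmenu : ∀ w ∈ fccSlots, ⟪Φ w, ν⟫_ℝ = 0 ∨ ⟪Φ w, ν⟫_ℝ = Real.sqrt (2 / 3) ∨ ⟪Φ w, ν⟫_ℝ = -Real.sqrt (2 / 3))
    (hδ : δ ∈ fccSlots) (hpos : ⟪Φ δ, ν⟫_ℝ = Real.sqrt (2 / 3)) (hN : N = (2 * Real.sqrt (2 / 3)) • Φ δ - ν)
    (h3 : ∀ x ∈ fccStacking 1 (Real.sqrt (2 / 3)), ∃ a : ℤ,
      A.symm (Φ x - (a : ℝ) • (Real.sqrt (2 / 3) • ν)) ∈ fccStacking 1 (Real.sqrt (2 / 3)))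
    (h4 : ∀ x ∈ fccStacking 1 (Real.sqrt (2 / 3)), ∃ b : ℤ,
      A.symm (twinFrame Φ ν x - ((3 * b : ℤ) : ℝ) • (Real.sqrt (2 / 3) • ν)) ∈ fccStacking 1 (Real.sqrt (2 / 3)))
    (h6 : ∃ w : ℤ, ¬ (3 : ℤ) ∣ w ∧
      A.symm (((3 : ℝ) ^ k) • (Real.sqrt (2 / 3) • ν) - (w : ℝ) • g₀) ∈ fccStacking 1 (Real.sqrt (2 / 3)))
    (h7 : A.symm (((3 : ℝ) ^ (k + 1)) • (Real.sqrt (2 / 3) • ν)) ∈ fccStacking 1 (Real.sqrt (2 / 3))) :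
    ‖N‖ = 1 ∧
    (∀ w ∈ fccSlots, ⟪twinFrame Φ N w, N⟫_ℝ = 0 ∨ ⟪twinFrame Φ N w, N⟫_ℝ = Real.sqrt (2 / 3) ∨
      ⟪twinFrame Φ N w, N⟫_ℝ = -Real.sqrt (2 / 3)) ∧
    (∃ β : ℤ, A.symm ((3 : ℝ) • (Real.sqrt (2 / 3) • N) - ((12 * β + 5 : ℤ) : ℝ) • (Real.sqrt (2 / 3) • ν)) ∈
      fccStacking 1 (Real.sqrt (2 / 3))) ∧
    (∃ s : ℤ, A.symm (Real.sqrt (2 / 3) • ν - ((3 * s : ℤ) : ℝ) • (Real.sqrt (2 / 3) • N)) ∈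
      fccStacking 1 (Real.sqrt (2 / 3))) ∧
    (∀ x ∈ fccStacking 1 (Real.sqrt (2 / 3)), ∃ a : ℤ,
      A.symm (twinFrame Φ N x - (a : ℝ) • (Real.sqrt (2 / 3) • N)) ∈ fccStacking 1 (Real.sqrt (2 / 3))) ∧
    (∀ x ∈ fccStacking 1 (Real.sqrt (2 / 3)), ∃ b : ℤ,
      A.symm (twinFrame (twinFrame Φ N) N x - ((3 * b : ℤ) : ℝ) • (Real.sqrt (2 / 3) • N)) ∈
        fccStacking 1 (Real.sqrt (2 / 3))) ∧
    A.symm (((3 : ℝ) ^ (k + 2)) • (Real.sqrt (2 / 3) • N)) ∈ fccStacking 1 (Real.sqrt (2 / 3)) ∧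
    (∃ w : ℤ, ¬ (3 : ℤ) ∣ w ∧
      A.symm (((3 : ℝ) ^ (k + 1)) • (Real.sqrt (2 / 3) • N) - (w : ℝ) • g₀) ∈ fccStacking 1 (Real.sqrt (2 / 3))) := by
  have h23 : Real.sqrt (2 / 3) * Real.sqrt (2 / 3) = 2 / 3 := Real.mul_self_sqrt (by norm_num)
  set d₀ : ℝ := Real.sqrt (2 / 3) with hd₀
  set g : EuclideanSpace ℝ (Fin 3) := d₀ • ν with hg
  set g' : EuclideanSpace ℝ (Fin 3) := d₀ • N with hg'
  -- `N` is a unit menu normal of `Φ`, hence of the twin frame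
  have hNunit : ‖N‖ = 1 := by rw [hN]; exact norm_mirror_slot Φ hν hδ hpos
  have hNmenu := menu_mirror_slot Φ hmenu hδ hpos
  rw [← hN] at hNmenu
  have hNmenu' := menu_reflect Φ (twinFrame Φ N) hNunit hNmenu (twinFrame_apply Φ hNunit)
  -- the capper `c = Φ δ` and the lattice vector below it, `y = R_ν c = c − 2g`
  have hy : twinFrame Φ ν δ = Φ δ - (2 : ℝ) • g := by
    rw [twinFrame_apply Φ hν, hpos, hg, smul_smul]
  obtain ⟨b, hb⟩ := h4 δ (mem_fcc_of_mem_fccSlots hδ)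
  -- `λ₁ := c − (3b+2) g ∈ M`
  have hlam : A.symm (Φ δ - ((3 * b + 2 : ℤ) : ℝ) • g) ∈ fccStacking 1 (Real.sqrt (2 / 3)) := by
    have e : Φ δ - ((3 * b + 2 : ℤ) : ℝ) • g = twinFrame Φ ν δ - ((3 * b : ℤ) : ℝ) • g := by
      rw [hy]; push_cast; module
    rw [e]; exact hb
  -- `g' = (4/3) c − g`, so `3 g' = 4 c − 3 g = 4 λ₁ + (12b+5) g`
  have hg'c : g' = (4 / 3 : ℝ) • Φ δ - g := by
    rw [hg', hN, smul_sub, smul_smul, hg]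
    congr 1
    rw [show d₀ * (2 * d₀) = 2 * (d₀ * d₀) by ring, h23]; norm_num
  have hrec : (3 : ℝ) • g' - ((12 * b + 5 : ℤ) : ℝ) • g = (4 : ℝ) • (Φ δ - ((3 * b + 2 : ℤ) : ℝ) • g) := by
    rw [hg'c]; push_cast; module
  have h9 : A.symm ((3 : ℝ) • g' - ((12 * b + 5 : ℤ) : ℝ) • g) ∈ fccStacking 1 (Real.sqrt (2 / 3)) := by
    rw [hrec, show (4 : ℝ) = ((4 : ℤ) : ℝ) by norm_num]
    exact symm_mem_fcc_zsmul A 4 hlam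
  -- Bezout: `12b+5` is prime to `3^{k+1}`, so `g ∈ M + 3ℤ g'`
  have hcop : IsCoprime (12 * b + 5 : ℤ) ((3 : ℤ) ^ (k + 1)) :=
    (show IsCoprime (12 * b + 5 : ℤ) 3 from ⟨-1, 4 * b + 2, by ring⟩).pow_right
  obtain ⟨s, t, hst⟩ := hcop
  have h8 : A.symm (g - ((3 * s : ℤ) : ℝ) • g') ∈ fccStacking 1 (Real.sqrt (2 / 3)) := by
    -- `g = s(12b+5) g + t 3^{k+1} g = s(3g' − 4λ₁) + t 3^{k+1} g`
    have e : g - ((3 * s : ℤ) : ℝ) • g' =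
        ((t : ℤ) : ℝ) • (((3 : ℝ) ^ (k + 1)) • g) - (s : ℝ) • ((3 : ℝ) • g' - ((12 * b + 5 : ℤ) : ℝ) • g) := by
      have hst' : ((s : ℝ) * (12 * b + 5) + t * 3 ^ (k + 1)) = 1 := by exact_mod_cast hst
      have hgs : g = ((s : ℝ) * (12 * b + 5) + t * 3 ^ (k + 1)) • g := by rw [hst', one_smul]
      push_cast
      conv_lhs => rw [hgs]
      module
    rw [e]
    exact symm_mem_fcc_sub A (symm_mem_fcc_zsmul A t h7) (by
      rw [show (s : ℝ) = ((s : ℤ) : ℝ) by rfl]; exact symm_mem_fcc_zsmul A s h9)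
  refine ⟨hNunit, hNmenu', ⟨b, h9⟩, ⟨s, h8⟩, ?_, ?_, ?_, ?_⟩
  · -- `R_N Φ x = Φ x − 2 a' g'`
    intro x hx
    obtain ⟨a, ha⟩ := h3 x hx
    obtain ⟨a', ha'⟩ := inner_lattice_menu Φ hNmenu hx
    refine ⟨a * (3 * s) - 2 * a', ?_⟩
    have e : twinFrame Φ N x - ((a * (3 * s) - 2 * a' : ℤ) : ℝ) • g' =
        (Φ x - (a : ℝ) • g) + (a : ℝ) • (g - ((3 * s : ℤ) : ℝ) • g') := by
      rw [twinFrame_apply Φ hNunit, ha', hg']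
      push_cast
      module
    rw [e]
    exact symm_mem_fcc_add A ha (by rw [show (a : ℝ) = ((a : ℤ) : ℝ) by rfl]; exact symm_mem_fcc_zsmul A a h8)
  · -- the frame below `R_N Φ` is `Φ`: `Φ x = (Φx − a g) + a (g − 3s g') + 3 a s g'`
    intro x hx
    obtain ⟨a, ha⟩ := h3 x hx
    refine ⟨a * s, ?_⟩
    rw [twinFrame_twinFrame Φ hNunit]
    have e : Φ x - ((3 * (a * s) : ℤ) : ℝ) • g' = (Φ x - (a : ℝ) • g) + (a : ℝ) • (g - ((3 * s : ℤ) : ℝ) • g') := by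
      push_cast; module
    rw [e]
    exact symm_mem_fcc_add A ha (by rw [show (a : ℝ) = ((a : ℤ) : ℝ) by rfl]; exact symm_mem_fcc_zsmul A a h8)
  · -- `3^{k+2} g' = 3^{k+1} (3g' − (12b+5)g) + (12b+5) 3^{k+1} g`
    have e : ((3 : ℝ) ^ (k + 2)) • g' = ((3 : ℝ) ^ (k + 1)) • ((3 : ℝ) • g' - ((12 * b + 5 : ℤ) : ℝ) • g) +
        ((12 * b + 5 : ℤ) : ℝ) • (((3 : ℝ) ^ (k + 1)) • g) := by
      push_cast; module
    rw [e]
    refine symm_mem_fcc_add A ?_ (symm_mem_fcc_zsmul A _ h7)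
    rw [show ((3 : ℝ) ^ (k + 1)) = (((3 ^ (k + 1) : ℤ)) : ℝ) by push_cast; ring]
    exact symm_mem_fcc_zsmul A _ h9
  · -- `3^{k+1} g' = 3^k (3g' − (12b+5) g) + (12b+5)(3^k g − w g₀) + (12b+5) w g₀`
    obtain ⟨w, hw3, hw⟩ := h6
    refine ⟨(12 * b + 5) * w, ?_, ?_⟩
    · intro hdvd
      have h3p : Prime (3 : ℤ) := Int.prime_three
      rcases h3p.dvd_or_dvd hdvd with h | h
      · have : (3 : ℤ) ∣ 12 * b + 5 - 3 * (4 * b + 1) := dvd_sub h (dvd_mul_right 3 _)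
        have h2 : (12 * b + 5 - 3 * (4 * b + 1) : ℤ) = 2 := by ring
        rw [h2] at this
        omega
      · exact hw3 h
    · have e : ((3 : ℝ) ^ (k + 1)) • g' - (((12 * b + 5) * w : ℤ) : ℝ) • g₀ =
          ((3 : ℝ) ^ k) • ((3 : ℝ) • g' - ((12 * b + 5 : ℤ) : ℝ) • g) +
          ((12 * b + 5 : ℤ) : ℝ) • (((3 : ℝ) ^ k) • g - (w : ℝ) • g₀) := by
        push_cast
        module
      rw [e]
      refine symm_mem_fcc_add A ?_ (symm_mem_fcc_zsmul A _ hw)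
      rw [show ((3 : ℝ) ^ k) = (((3 ^ k : ℤ)) : ℝ) by push_cast; ring]
      exact symm_mem_fcc_zsmul A _ h9

/-! ### The forced ray: positive directions and the invariant -/

/-- **The direction of a ray entry is a positive slot** whenever its normal is a unit menu normal of its frame. -/
theorem forcedTop_dir_mem_pos {z : EuclideanSpace ℝ (Fin 3)} {b : WalkEntry} {n : EuclideanSpace ℝ (Fin 3)} {k : ℕ}
    (hν : ‖(forcedTop z b n k).nrm‖ = 1)
    (hmenu : ∀ w ∈ fccSlots, ⟪(forcedTop z b n k).frame w, (forcedTop z b n k).nrm⟫_ℝ = 0 ∨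
      ⟪(forcedTop z b n k).frame w, (forcedTop z b n k).nrm⟫_ℝ = Real.sqrt (2 / 3) ∨
      ⟪(forcedTop z b n k).frame w, (forcedTop z b n k).nrm⟫_ℝ = -Real.sqrt (2 / 3)) :
    (forcedTop z b n k).dir ∈ fccSlots ∧
      ⟪(forcedTop z b n k).frame (forcedTop z b n k).dir, (forcedTop z b n k).nrm⟫_ℝ = Real.sqrt (2 / 3) := by
  classical
  set e := forcedTop z b n k with he
  have hr : 0 < Real.sqrt (2 / 3) := Real.sqrt_pos.2 (by norm_num)
  obtain ⟨p, hp, hpn, -⟩ := exists_pos_slot_ne e.frame hν hmenu 0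
  have hne : (fccSlots.filter fun q => 0 < ⟪e.frame q, e.nrm⟫_ℝ).Nonempty :=
    ⟨p, Finset.mem_filter.2 ⟨hp, by rw [hpn]; exact hr⟩⟩
  obtain ⟨hmem, -⟩ := bestCapper_spec e.frame e.nrm z hne
  rw [← forcedTop_dir z b n k, ← he, Finset.mem_filter] at hmem
  obtain ⟨hd, hdpos⟩ := hmem
  refine ⟨hd, ?_⟩
  rcases hmenu e.dir hd with h | h | h
  · rw [h] at hdpos; exact absurd hdpos (lt_irrefl 0)
  · exact h
  · rw [h] at hdpos; linarith

/-- `3 · √(2/3) = √6`. -/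
theorem three_mul_sqrt_twoThirds : (3 : ℝ) * Real.sqrt (2 / 3) = Real.sqrt 6 := by
  rw [show (6 : ℝ) = 3 ^ 2 * (2 / 3) by norm_num, Real.sqrt_mul (by norm_num : (0:ℝ) ≤ 3 ^ 2),
    Real.sqrt_sq (by norm_num : (0:ℝ) ≤ 3)]

/-- **The chain invariant along a forced ray** (see the module docstring).  Base frame `A`, any `u`, first push normal `n`
a unit menu normal of `A`; `M`-membership spelled `A⁻¹(·) ∈ Λ₀`; `g_k = √(2/3)·ν_k`. -/
theorem forcedTop_chain_invariant (z : EuclideanSpace ℝ (Fin 3))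
    (A : EuclideanSpace ℝ (Fin 3) ≃ₗᵢ[ℝ] EuclideanSpace ℝ (Fin 3)) (u : EuclideanSpace ℝ (Fin 3))
    {n : EuclideanSpace ℝ (Fin 3)} (hn : ‖n‖ = 1)
    (hmenu : ∀ w ∈ fccSlots, ⟪A w, n⟫_ℝ = 0 ∨ ⟪A w, n⟫_ℝ = Real.sqrt (2 / 3) ∨ ⟪A w, n⟫_ℝ = -Real.sqrt (2 / 3))
    (k : ℕ) :
    ‖(forcedTop z ⟨A, u, 0⟩ n k).nrm‖ = 1 ∧
    (∀ w ∈ fccSlots, ⟪(forcedTop z ⟨A, u, 0⟩ n k).frame w, (forcedTop z ⟨A, u, 0⟩ n k).nrm⟫_ℝ = 0 ∨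
      ⟪(forcedTop z ⟨A, u, 0⟩ n k).frame w, (forcedTop z ⟨A, u, 0⟩ n k).nrm⟫_ℝ = Real.sqrt (2 / 3) ∨
      ⟪(forcedTop z ⟨A, u, 0⟩ n k).frame w, (forcedTop z ⟨A, u, 0⟩ n k).nrm⟫_ℝ = -Real.sqrt (2 / 3)) ∧
    (∀ x ∈ fccStacking 1 (Real.sqrt (2 / 3)), ∃ b : ℤ,
      A.symm (twinFrame (forcedTop z ⟨A, u, 0⟩ n k).frame (forcedTop z ⟨A, u, 0⟩ n k).nrm x -
        ((3 * b : ℤ) : ℝ) • (Real.sqrt (2 / 3) • (forcedTop z ⟨A, u, 0⟩ n k).nrm)) ∈ fccStacking 1 (Real.sqrt (2 / 3))) ∧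
    (∃ w : ℤ, ¬ (3 : ℤ) ∣ w ∧
      A.symm (((3 : ℝ) ^ k) • (Real.sqrt (2 / 3) • (forcedTop z ⟨A, u, 0⟩ n k).nrm) - (w : ℝ) • (Real.sqrt (2 / 3) • n)) ∈
        fccStacking 1 (Real.sqrt (2 / 3))) ∧
    A.symm (((3 : ℝ) ^ (k + 1)) • (Real.sqrt (2 / 3) • (forcedTop z ⟨A, u, 0⟩ n k).nrm)) ∈ fccStacking 1 (Real.sqrt (2 / 3)) ∧
    (∀ j ≤ k, ∀ x ∈ fccStacking 1 (Real.sqrt (2 / 3)), ∃ a : ℤ,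
      A.symm ((forcedTop z ⟨A, u, 0⟩ n j).frame x - (a : ℝ) • (Real.sqrt (2 / 3) • (forcedTop z ⟨A, u, 0⟩ n k).nrm)) ∈
        fccStacking 1 (Real.sqrt (2 / 3))) := by
  induction k with
  | zero =>
    -- level 0: frame `R_n A`, normal `n`
    have hfr : (forcedTop z ⟨A, u, 0⟩ n 0).frame = twinFrame A n := rfl
    have hnr : (forcedTop z ⟨A, u, 0⟩ n 0).nrm = n := rfl
    rw [hfr, hnr]
    have h3 : ∀ x ∈ fccStacking 1 (Real.sqrt (2 / 3)), ∃ a : ℤ,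
        A.symm (twinFrame A n x - (a : ℝ) • (Real.sqrt (2 / 3) • n)) ∈ fccStacking 1 (Real.sqrt (2 / 3)) := by
      intro x hx
      obtain ⟨a', ha'⟩ := inner_lattice_menu A hmenu hx
      refine ⟨-(2 * a'), ?_⟩
      have e : twinFrame A n x - ((-(2 * a') : ℤ) : ℝ) • (Real.sqrt (2 / 3) • n) = A x := by
        rw [twinFrame_apply A hn, ha']; push_cast; module
      rw [e, LinearIsometryEquiv.symm_apply_apply]; exact hx
    refine ⟨hn, menu_reflect A _ hn hmenu (twinFrame_apply A hn), ?_, ⟨1, by decide, ?_⟩, ?_, ?_⟩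
    · intro x hx
      refine ⟨0, ?_⟩
      rw [twinFrame_twinFrame A hn]
      have e : A x - ((3 * 0 : ℤ) : ℝ) • (Real.sqrt (2 / 3) • n) = A x := by push_cast; module
      rw [e, LinearIsometryEquiv.symm_apply_apply]; exact hx
    · have e : ((3 : ℝ) ^ 0) • (Real.sqrt (2 / 3) • n) - ((1 : ℤ) : ℝ) • (Real.sqrt (2 / 3) • n) = 0 := by
        push_cast; module
      rw [e]; exact symm_mem_fcc_zero A
    · obtain ⟨y, hy, hAy⟩ := exists_lattice_eq_sqrt6_menu A hmenu
      have e : ((3 : ℝ) ^ (0 + 1)) • (Real.sqrt (2 / 3) • n) = A y := by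
        rw [hAy, smul_smul, zero_add, pow_one, three_mul_sqrt_twoThirds]
      rw [e, LinearIsometryEquiv.symm_apply_apply]; exact hy
    · intro j hj x hx
      obtain rfl : j = 0 := Nat.le_zero.1 hj
      rw [hfr]
      exact h3 x hx
  | succ k ih =>
    obtain ⟨hν, hmenuk, h4, h6, h7, h8⟩ := ih
    have h3 := h8 k le_rfl
    set e := forcedTop z ⟨A, u, 0⟩ n k with he
    obtain ⟨hd, hpos⟩ := forcedTop_dir_mem_pos (z := z) (b := ⟨A, u, 0⟩) (n := n) (k := k) hν hmenuk
    rw [← he] at hd hpos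
    have hN : nextNormal e = (2 * Real.sqrt (2 / 3)) • e.frame e.dir - e.nrm := rfl
    obtain ⟨c1, c2, -, ⟨s, c8⟩, c3, c4, c7, c6⟩ := chain_step A e.frame k hν hmenuk hd hpos hN h3 h4 h6 h7
    have hfr : (forcedTop z ⟨A, u, 0⟩ n (k + 1)).frame = twinFrame e.frame (nextNormal e) := rfl
    have hnr : (forcedTop z ⟨A, u, 0⟩ n (k + 1)).nrm = nextNormal e := rfl
    rw [hfr, hnr]
    refine ⟨c1, c2, c4, c6, ?_, ?_⟩
    · rw [show k + 1 + 1 = k + 2 by ring]; exact c7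
    · intro j hj x hx
      rcases Nat.lt_or_ge j (k + 1) with hlt | hge
      · -- an earlier frame: lift from `M + ℤ g_k` to `M + ℤ g_{k+1}`
        obtain ⟨a, ha⟩ := h8 j (Nat.lt_succ_iff.1 hlt) x hx
        refine ⟨3 * s * a, ?_⟩
        have e' : (forcedTop z ⟨A, u, 0⟩ n j).frame x - ((3 * s * a : ℤ) : ℝ) • (Real.sqrt (2 / 3) • nextNormal e) =
            ((forcedTop z ⟨A, u, 0⟩ n j).frame x - (a : ℝ) • (Real.sqrt (2 / 3) • e.nrm)) +
            (a : ℝ) • (Real.sqrt (2 / 3) • e.nrm - ((3 * s : ℤ) : ℝ) • (Real.sqrt (2 / 3) • nextNormal e)) := by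
          push_cast; module
        rw [e']
        exact symm_mem_fcc_add A ha (symm_mem_fcc_zsmul A a c8)
      · obtain rfl : j = k + 1 := le_antisymm hj hge
        rw [hfr]
        exact c3 x hx

/-- **The recursion `3·g_{k+1} ≡ (12β+5)·g_k (mod M)`** along a forced ray, and `g_k ∈ M + 3ℤ·g_{k+1}`. -/
theorem forcedTop_chain_recursion (z : EuclideanSpace ℝ (Fin 3))
    (A : EuclideanSpace ℝ (Fin 3) ≃ₗᵢ[ℝ] EuclideanSpace ℝ (Fin 3)) (u : EuclideanSpace ℝ (Fin 3))
    {n : EuclideanSpace ℝ (Fin 3)} (hn : ‖n‖ = 1)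
    (hmenu : ∀ w ∈ fccSlots, ⟪A w, n⟫_ℝ = 0 ∨ ⟪A w, n⟫_ℝ = Real.sqrt (2 / 3) ∨ ⟪A w, n⟫_ℝ = -Real.sqrt (2 / 3))
    (k : ℕ) :
    (∃ β : ℤ, A.symm ((3 : ℝ) • (Real.sqrt (2 / 3) • (forcedTop z ⟨A, u, 0⟩ n (k + 1)).nrm) -
      ((12 * β + 5 : ℤ) : ℝ) • (Real.sqrt (2 / 3) • (forcedTop z ⟨A, u, 0⟩ n k).nrm)) ∈ fccStacking 1 (Real.sqrt (2 / 3))) ∧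
    (∃ s : ℤ, A.symm (Real.sqrt (2 / 3) • (forcedTop z ⟨A, u, 0⟩ n k).nrm -
      ((3 * s : ℤ) : ℝ) • (Real.sqrt (2 / 3) • (forcedTop z ⟨A, u, 0⟩ n (k + 1)).nrm)) ∈ fccStacking 1 (Real.sqrt (2 / 3))) := by
  obtain ⟨hν, hmenuk, h4, h6, h7, h8⟩ := forcedTop_chain_invariant z A u hn hmenu k
  have h3 := h8 k le_rfl
  set e := forcedTop z ⟨A, u, 0⟩ n k with he
  obtain ⟨hd, hpos⟩ := forcedTop_dir_mem_pos (z := z) (b := ⟨A, u, 0⟩) (n := n) (k := k) hν hmenuk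
  rw [← he] at hd hpos
  have hN : nextNormal e = (2 * Real.sqrt (2 / 3)) • e.frame e.dir - e.nrm := rfl
  obtain ⟨-, -, c9, c8, -⟩ := chain_step A e.frame k hν hmenuk hd hpos hN h3 h4 h6 h7
  have hnr : (forcedTop z ⟨A, u, 0⟩ n (k + 1)).nrm = nextNormal e := rfl
  rw [hnr]
  exact ⟨c9, c8⟩

end Summit.Ventures.Crystal3D.Theorems

end
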